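import Summits.SmoothPoincare4.SmoothPoincare4.Theses.CongruenceShadows

/-!
# `WaldhausenPairs` — negative-side support (3): symmetries of the standard pair

Refuter support lemma (cdisprove seat) for crux item stmt-SmoothPoincare4-14592
(`CongruenceShadows.WaldhausenPairs`). The crux asks for an ORDERED equivalence of Heegaard
pairs: one `α ∈ Aut S_g` with `α N_i = K_i` AND `α N_j = K_j`. Waldhausen's uniqueness of
genus-`g` splittings of `#ᵏ(S¹ × S²)` is a priori unordered; the ordered form follows because
the standard pair has a side swap. Here it is at genus `3` (`m = 0`), purely algebraically:
`swapEquiv = σ ∈ Aut S_3` (identity on the shared handle, the half-twist `a ↦ b⁻¹, b ↦ bab⁻¹`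
— which fixes `[a,b]` letter for letter — on the two other handles) satisfies `σ N₀ = N₁` and
`σ N₁ = N₀` (`exists_swap_s4Kernels`), whence `crossed_of_pair_zero_one`: the conclusion of the
crux for the pair `(0,1)` is equivalent to its crossed form. So the ordered conclusion is not a
mis-statement, and an unordered vendored Waldhausen fact suffices at genus 3.

Second: `dehnEquiv h` (the Dehn twist `T_h : b_h ↦ b_h a_h`) and the REFUTED STRENGTHENING
`not_pairsDetermineThird` — "an automorphism standardising the pair `(K₀,K₁)` also standardises
`K₂`" fails at `K = N`, `m = 0`, `α = T₀` (twist about the shared curve `a₁`: `T₀ ∈ Stab N₀ ∩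
Stab N₁`, `T₀ N₂ ≠ N₂`). This is the exact gap between the crux (pairs) and simultaneous
standardness `Iso N K` (the route's target modulo stabilisation, SPC4-hard).
-/

-- the prescribed namespace `Summit.<P>.<Sub>.…` duplicates `SmoothPoincare4` (P = Sub)
set_option linter.dupNamespace false

noncomputable section

namespace Summit.SmoothPoincare4.SmoothPoincare4.Theorems.WaldhausenPairs.Negative

open Literature.Topology.FourManifolds Subgroup

/-! ## The side swap `σ` of the standard genus-3 Heegaard pair `(N₀, N₁)` -/

/-- Generator images of the side swap `σ`: identity on the shared handle `0`, the half-twist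
`φ = T_a T_b⁻¹ T_a : a ↦ b⁻¹, b ↦ b a b⁻¹` (which fixes `[a,b]` letter for letter) on handles
`1, 2`. [folklore] -/
def swapGen (x : surfaceGen 3) : FreeGroup (surfaceGen 3) :=
  if x.1 = 0 then FreeGroup.of x
  else if x.2 = false then (FreeGroup.of (x.1, true))⁻¹
  else FreeGroup.of (x.1, true) * FreeGroup.of (x.1, false) * (FreeGroup.of (x.1, true))⁻¹

/-- Generator images of `σ⁻¹`: `a ↦ a b a⁻¹, b ↦ a⁻¹` on handles `1, 2`. [folklore] -/
def unswapGen (x : surfaceGen 3) : FreeGroup (surfaceGen 3) :=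
  if x.1 = 0 then FreeGroup.of x
  else if x.2 = false then FreeGroup.of (x.1, false) * FreeGroup.of (x.1, true) * (FreeGroup.of (x.1, false))⁻¹
  else (FreeGroup.of (x.1, false))⁻¹

/-- `σ` fixes each commutator `[aᵢ, bᵢ]` in the free group. [folklore] -/
theorem lift_swapGen_comm (i : Fin 3) :
    FreeGroup.lift swapGen (genA i * genB i * (genA i)⁻¹ * (genB i)⁻¹) =
      genA i * genB i * (genA i)⁻¹ * (genB i)⁻¹ := by
  fin_cases i
  · simp [swapGen, genA, genB]
  · simp only [swapGen, genA, genB, map_mul, map_inv, FreeGroup.lift_apply_of]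
    simp
    group
  · simp only [swapGen, genA, genB, map_mul, map_inv, FreeGroup.lift_apply_of]
    simp
    group

/-- `σ⁻¹` fixes each commutator `[aᵢ, bᵢ]` in the free group. [folklore] -/
theorem lift_unswapGen_comm (i : Fin 3) :
    FreeGroup.lift unswapGen (genA i * genB i * (genA i)⁻¹ * (genB i)⁻¹) =
      genA i * genB i * (genA i)⁻¹ * (genB i)⁻¹ := by
  fin_cases i
  · simp [unswapGen, genA, genB]
  · simp only [unswapGen, genA, genB, map_mul, map_inv, FreeGroup.lift_apply_of]
    simp
    group
  · simp only [unswapGen, genA, genB, map_mul, map_inv, FreeGroup.lift_apply_of]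
    simp
    group

/-- `σ` fixes the surface relator. [folklore] -/
theorem lift_swapGen_surfaceRelator :
    FreeGroup.lift swapGen (surfaceRelator 3) = surfaceRelator 3 := by
  unfold surfaceRelator
  rw [map_list_prod, List.map_map]
  exact congrArg List.prod (List.map_congr_left fun i _ => lift_swapGen_comm i)

/-- `σ⁻¹` fixes the surface relator. [folklore] -/
theorem lift_unswapGen_surfaceRelator :
    FreeGroup.lift unswapGen (surfaceRelator 3) = surfaceRelator 3 := by
  unfold surfaceRelator
  rw [map_list_prod, List.map_map]
  exact congrArg List.prod (List.map_congr_left fun i _ => lift_unswapGen_comm i)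

/-- `σ` as an endomorphism of `S_3`. [folklore] -/
def swapHom : SurfaceGroup 3 →* SurfaceGroup 3 :=
  presentedLift ((PresentedGroup.mk _).comp (FreeGroup.lift swapGen)) (by
    intro r hr
    rw [Set.mem_singleton_iff] at hr
    subst hr
    rw [MonoidHom.comp_apply, lift_swapGen_surfaceRelator]
    exact PresentedGroup.one_of_mem (Set.mem_singleton _))

/-- `σ⁻¹` as an endomorphism of `S_3`. [folklore] -/
def unswapHom : SurfaceGroup 3 →* SurfaceGroup 3 :=
  presentedLift ((PresentedGroup.mk _).comp (FreeGroup.lift unswapGen)) (by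
    intro r hr
    rw [Set.mem_singleton_iff] at hr
    subst hr
    rw [MonoidHom.comp_apply, lift_unswapGen_surfaceRelator]
    exact PresentedGroup.one_of_mem (Set.mem_singleton _))

/-- `σ` on the class of a word. [folklore] -/
@[simp] theorem swapHom_mk (w : FreeGroup (surfaceGen 3)) :
    swapHom (PresentedGroup.mk _ w) = PresentedGroup.mk _ (FreeGroup.lift swapGen w) := by
  simp [swapHom]

/-- `σ⁻¹` on the class of a word. [folklore] -/
@[simp] theorem unswapHom_mk (w : FreeGroup (surfaceGen 3)) :
    unswapHom (PresentedGroup.mk _ w) = PresentedGroup.mk _ (FreeGroup.lift unswapGen w) := by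
  simp [unswapHom]

/-- The side swap `σ` as an automorphism of `S_3` (product of half-twists on handles 1, 2).
[folklore] -/
def swapEquiv : SurfaceGroup 3 ≃* SurfaceGroup 3 :=
  MonoidHom.toMulEquiv swapHom unswapHom
    (PresentedGroup.ext fun x => by
      obtain ⟨k, b⟩ := x
      fin_cases k <;> cases b <;> simp [swapGen, unswapGen, PresentedGroup.of, mul_assoc])
    (PresentedGroup.ext fun x => by
      obtain ⟨k, b⟩ := x
      fin_cases k <;> cases b <;> simp [swapGen, unswapGen, PresentedGroup.of, mul_assoc])

/-- `σ a₁ = a₁`. [folklore] -/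
theorem swapEquiv_a_zero : swapEquiv (SurfaceGroup.a 0) = SurfaceGroup.a 0 := by
  simp [swapEquiv, SurfaceGroup.a, swapGen, PresentedGroup.of]

/-- `σ b₁ = b₁`. [folklore] -/
theorem swapEquiv_b_zero : swapEquiv (SurfaceGroup.b 0) = SurfaceGroup.b 0 := by
  simp [swapEquiv, SurfaceGroup.b, swapGen, PresentedGroup.of]

/-- `σ a₂ = b₂⁻¹`. [folklore] -/
theorem swapEquiv_a_one : swapEquiv (SurfaceGroup.a 1) = (SurfaceGroup.b 1)⁻¹ := by
  simp [swapEquiv, SurfaceGroup.a, SurfaceGroup.b, swapGen, PresentedGroup.of]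

/-- `σ a₃ = b₃⁻¹`. [folklore] -/
theorem swapEquiv_a_two : swapEquiv (SurfaceGroup.a 2) = (SurfaceGroup.b 2)⁻¹ := by
  simp [swapEquiv, SurfaceGroup.a, SurfaceGroup.b, swapGen, PresentedGroup.of]

/-- `σ b₂ = b₂ a₂ b₂⁻¹`. [folklore] -/
theorem swapEquiv_b_one :
    swapEquiv (SurfaceGroup.b 1) = SurfaceGroup.b 1 * SurfaceGroup.a 1 * (SurfaceGroup.b 1)⁻¹ := by
  simp [swapEquiv, SurfaceGroup.a, SurfaceGroup.b, swapGen, PresentedGroup.of, mul_assoc]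

/-- `σ b₃ = b₃ a₃ b₃⁻¹`. [folklore] -/
theorem swapEquiv_b_two :
    swapEquiv (SurfaceGroup.b 2) = SurfaceGroup.b 2 * SurfaceGroup.a 2 * (SurfaceGroup.b 2)⁻¹ := by
  simp [swapEquiv, SurfaceGroup.a, SurfaceGroup.b, swapGen, PresentedGroup.of, mul_assoc]

/-- Normal closures are insensitive to inverting a generator and conjugating another.
[folklore] -/
theorem normalClosure_triple_eq {G : Type*} [Group G] (x y z g : G) :
    normalClosure ({x, y⁻¹, g * z * g⁻¹} : Set G) = normalClosure {x, y, z} := by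
  apply le_antisymm
  · refine normalClosure_le_normal ?_
    rintro w (rfl | rfl | rfl)
    · exact subset_normalClosure (by simp)
    · exact inv_mem (subset_normalClosure (by simp))
    · exact (normalClosure_normal (s := ({x, y, z} : Set G))).conj_mem _
        (subset_normalClosure (by simp)) g
  · refine normalClosure_le_normal ?_
    rintro w (rfl | rfl | rfl)
    · exact subset_normalClosure (by simp)
    · rw [← inv_inv w]
      exact inv_mem (subset_normalClosure (by simp))
    · have hmem : g * w * g⁻¹ ∈ normalClosure ({x, y⁻¹, g * w * g⁻¹} : Set G) :=
        subset_normalClosure (by simp)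
      have key := (normalClosure_normal (s := ({x, y⁻¹, g * w * g⁻¹} : Set G))).conj_mem _ hmem g⁻¹
      simpa [mul_assoc] using key

/-- `σ N₀ = N₁`. [folklore] -/
theorem map_swap_s4Kernels_zero :
    (s4Kernels 0).map swapEquiv.toMonoidHom = s4Kernels 1 := by
  have h0 : s4Kernels 0 = normalClosure {SurfaceGroup.a 0, SurfaceGroup.a 1, SurfaceGroup.b 2} := rfl
  have h1 : s4Kernels 1 = normalClosure {SurfaceGroup.a 0, SurfaceGroup.b 1, SurfaceGroup.a 2} := rfl
  rw [h0, h1, map_normalClosure _ swapEquiv.toMonoidHom (by exact swapEquiv.surjective)]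
  simp only [Set.image_insert_eq, Set.image_singleton, MulEquiv.coe_toMonoidHom, swapEquiv_a_zero,
    swapEquiv_a_one, swapEquiv_b_two]
  exact normalClosure_triple_eq _ _ _ _

/-- `σ N₁ = N₀`. [folklore] -/
theorem map_swap_s4Kernels_one :
    (s4Kernels 1).map swapEquiv.toMonoidHom = s4Kernels 0 := by
  have h0 : s4Kernels 0 = normalClosure {SurfaceGroup.a 0, SurfaceGroup.a 1, SurfaceGroup.b 2} := rfl
  have h1 : s4Kernels 1 = normalClosure {SurfaceGroup.a 0, SurfaceGroup.b 1, SurfaceGroup.a 2} := rfl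
  rw [h0, h1, map_normalClosure _ swapEquiv.toMonoidHom (by exact swapEquiv.surjective)]
  simp only [Set.image_insert_eq, Set.image_singleton, MulEquiv.coe_toMonoidHom, swapEquiv_a_zero,
    swapEquiv_b_one, swapEquiv_a_two]
  -- {a₀, b₁ a₁ b₁⁻¹, b₂⁻¹} vs {a₀, a₁, b₂}: reorder to apply the triple lemma
  have : ({SurfaceGroup.a 0, SurfaceGroup.b 1 * SurfaceGroup.a 1 * (SurfaceGroup.b 1)⁻¹,
      (SurfaceGroup.b 2)⁻¹} : Set (SurfaceGroup 3)) =
      {SurfaceGroup.a 0, (SurfaceGroup.b 2)⁻¹, SurfaceGroup.b 1 * SurfaceGroup.a 1 * (SurfaceGroup.b 1)⁻¹} := by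
    ext w; simp [or_comm]
  rw [this, normalClosure_triple_eq]
  congr 1
  ext w; simp [or_comm]

/-- ORDERED = UNORDERED (sanity of the ordered conclusion): the standard genus-3 Heegaard pair
`(N₀, N₁)` of `S¹×S²` admits a side swap in `Aut S_3`. Hence an unordered Waldhausen
equivalence `{K_i, K_j} ~ {N_i, N_j}` can always be corrected to the ordered one the crux asks
for (at `m = 0`; in general by the analogous product of half-twists on the non-shared handles).
[folklore] -/
theorem exists_swap_s4Kernels :
    ∃ σ : SurfaceGroup 3 ≃* SurfaceGroup 3,
      (s4Kernels 0).map σ.toMonoidHom = s4Kernels 1 ∧ (s4Kernels 1).map σ.toMonoidHom = s4Kernels 0 :=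
  ⟨swapEquiv, map_swap_s4Kernels_zero, map_swap_s4Kernels_one⟩

/-- Consequence for the prover: at `m = 0` the conclusion of the crux for the pair `(0,1)` is
equivalent to its CROSSED form (compose with `σ`), so an UNORDERED Waldhausen equivalence of the
Heegaard pair suffices at genus 3. [folklore] -/
theorem crossed_of_pair_zero_one {K : TrisectionKernels 3}
    (h : ∃ α : SurfaceGroup 3 ≃* SurfaceGroup 3,
      (s4Kernels 0).map α.toMonoidHom = K 0 ∧ (s4Kernels 1).map α.toMonoidHom = K 1) :
    ∃ β : SurfaceGroup 3 ≃* SurfaceGroup 3,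
      (s4Kernels 0).map β.toMonoidHom = K 1 ∧ (s4Kernels 1).map β.toMonoidHom = K 0 := by
  obtain ⟨α, h0, h1⟩ := h
  have ht : (swapEquiv.trans α).toMonoidHom = α.toMonoidHom.comp swapEquiv.toMonoidHom :=
    MonoidHom.ext fun _ => rfl
  refine ⟨swapEquiv.trans α, ?_, ?_⟩
  · rw [ht, ← Subgroup.map_map, map_swap_s4Kernels_zero, h1]
  · rw [ht, ← Subgroup.map_map, map_swap_s4Kernels_one, h0]

/-! ## Dehn twists `T_h`; the Heegaard group of `(N₀,N₁)` moves `N₂` -/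

/-- Generator images of the Dehn twist `T_h : b_h ↦ b_h a_h` about `a_h` (handle `h`), on the
free group. [folklore] -/
def dehnGen (h : Fin 3) (x : surfaceGen 3) : FreeGroup (surfaceGen 3) :=
  if x = (h, true) then FreeGroup.of (h, true) * FreeGroup.of (h, false) else FreeGroup.of x

/-- Generator images of `T_h⁻¹ : b_h ↦ b_h a_h⁻¹`. [folklore] -/
def undehnGen (h : Fin 3) (x : surfaceGen 3) : FreeGroup (surfaceGen 3) :=
  if x = (h, true) then FreeGroup.of (h, true) * (FreeGroup.of (h, false))⁻¹ else FreeGroup.of x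

/-- `T_h` fixes each commutator `[aᵢ, bᵢ]` in the free group. [folklore] -/
theorem lift_dehnGen_comm (h i : Fin 3) :
    FreeGroup.lift (dehnGen h) (genA i * genB i * (genA i)⁻¹ * (genB i)⁻¹) =
      genA i * genB i * (genA i)⁻¹ * (genB i)⁻¹ := by
  simp only [dehnGen, genA, genB, map_mul, map_inv, FreeGroup.lift_apply_of]
  by_cases hi : i = h
  · subst hi
    simp
    group
  · have h1 : ((i, false) : surfaceGen 3) ≠ (h, true) := by simp
    have h2 : ((i, true) : surfaceGen 3) ≠ (h, true) := by simpa using hi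
    simp [h1, h2]

/-- `T_h⁻¹` fixes each commutator `[aᵢ, bᵢ]` in the free group. [folklore] -/
theorem lift_undehnGen_comm (h i : Fin 3) :
    FreeGroup.lift (undehnGen h) (genA i * genB i * (genA i)⁻¹ * (genB i)⁻¹) =
      genA i * genB i * (genA i)⁻¹ * (genB i)⁻¹ := by
  simp only [undehnGen, genA, genB, map_mul, map_inv, FreeGroup.lift_apply_of]
  by_cases hi : i = h
  · subst hi
    simp
    group
  · have h1 : ((i, false) : surfaceGen 3) ≠ (h, true) := by simp
    have h2 : ((i, true) : surfaceGen 3) ≠ (h, true) := by simpa using hi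
    simp [h1, h2]

/-- `T_h` fixes the surface relator. [folklore] -/
theorem lift_dehnGen_surfaceRelator (h : Fin 3) :
    FreeGroup.lift (dehnGen h) (surfaceRelator 3) = surfaceRelator 3 := by
  unfold surfaceRelator
  rw [map_list_prod, List.map_map]
  exact congrArg List.prod (List.map_congr_left fun i _ => lift_dehnGen_comm h i)

/-- `T_h⁻¹` fixes the surface relator. [folklore] -/
theorem lift_undehnGen_surfaceRelator (h : Fin 3) :
    FreeGroup.lift (undehnGen h) (surfaceRelator 3) = surfaceRelator 3 := by
  unfold surfaceRelator
  rw [map_list_prod, List.map_map]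
  exact congrArg List.prod (List.map_congr_left fun i _ => lift_undehnGen_comm h i)

/-- `T_h` as an endomorphism of `S_3`. [folklore] -/
def dehnHom (h : Fin 3) : SurfaceGroup 3 →* SurfaceGroup 3 :=
  presentedLift ((PresentedGroup.mk _).comp (FreeGroup.lift (dehnGen h))) (by
    intro r hr
    rw [Set.mem_singleton_iff] at hr
    subst hr
    rw [MonoidHom.comp_apply, lift_dehnGen_surfaceRelator]
    exact PresentedGroup.one_of_mem (Set.mem_singleton _))

/-- `T_h⁻¹` as an endomorphism of `S_3`. [folklore] -/
def undehnHom (h : Fin 3) : SurfaceGroup 3 →* SurfaceGroup 3 :=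
  presentedLift ((PresentedGroup.mk _).comp (FreeGroup.lift (undehnGen h))) (by
    intro r hr
    rw [Set.mem_singleton_iff] at hr
    subst hr
    rw [MonoidHom.comp_apply, lift_undehnGen_surfaceRelator]
    exact PresentedGroup.one_of_mem (Set.mem_singleton _))

/-- `T_h` on the class of a word. [folklore] -/
@[simp] theorem dehnHom_mk (h : Fin 3) (w : FreeGroup (surfaceGen 3)) :
    dehnHom h (PresentedGroup.mk _ w) = PresentedGroup.mk _ (FreeGroup.lift (dehnGen h) w) := by
  simp [dehnHom]

/-- `T_h⁻¹` on the class of a word. [folklore] -/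
@[simp] theorem undehnHom_mk (h : Fin 3) (w : FreeGroup (surfaceGen 3)) :
    undehnHom h (PresentedGroup.mk _ w) = PresentedGroup.mk _ (FreeGroup.lift (undehnGen h) w) := by
  simp [undehnHom]

/-- The Dehn twist `T_h : b_h ↦ b_h a_h` as an automorphism of `S_3`. [folklore] -/
def dehnEquiv (h : Fin 3) : SurfaceGroup 3 ≃* SurfaceGroup 3 :=
  MonoidHom.toMulEquiv (dehnHom h) (undehnHom h)
    (PresentedGroup.ext fun x => by
      obtain ⟨k, b⟩ := x
      fin_cases h <;> fin_cases k <;> cases b <;> simp [dehnGen, undehnGen, PresentedGroup.of])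
    (PresentedGroup.ext fun x => by
      obtain ⟨k, b⟩ := x
      fin_cases h <;> fin_cases k <;> cases b <;> simp [dehnGen, undehnGen, PresentedGroup.of])

/-- `T_h` fixes every `aᵢ`. [folklore] -/
theorem dehnEquiv_a (h i : Fin 3) : dehnEquiv h (SurfaceGroup.a i) = SurfaceGroup.a i := by
  fin_cases h <;> fin_cases i <;> simp [dehnEquiv, SurfaceGroup.a, dehnGen, PresentedGroup.of]

/-- `T_h` fixes `bᵢ` for `i ≠ h`. [folklore] -/
theorem dehnEquiv_b_of_ne {h i : Fin 3} (hi : i ≠ h) :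
    dehnEquiv h (SurfaceGroup.b i) = SurfaceGroup.b i := by
  fin_cases h <;> fin_cases i <;> first | exact absurd rfl hi |
    simp [dehnEquiv, SurfaceGroup.b, dehnGen, PresentedGroup.of]

/-- `T_h b_h = b_h a_h`. [folklore] -/
theorem dehnEquiv_b_self (h : Fin 3) :
    dehnEquiv h (SurfaceGroup.b h) = SurfaceGroup.b h * SurfaceGroup.a h := by
  fin_cases h <;> simp [dehnEquiv, SurfaceGroup.b, SurfaceGroup.a, dehnGen, PresentedGroup.of]

/-- `T₀` (twist about the SHARED curve `a₁` of the pair `(N₀, N₁)`) stabilises `N₀ = ⟪a₁,a₂,b₃⟫`.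
[folklore] -/
theorem map_dehnZero_s4Kernels_zero :
    (s4Kernels 0).map (dehnEquiv 0).toMonoidHom = s4Kernels 0 := by
  have h0 : s4Kernels 0 = normalClosure {SurfaceGroup.a 0, SurfaceGroup.a 1, SurfaceGroup.b 2} := rfl
  rw [h0, map_normalClosure _ (dehnEquiv 0).toMonoidHom (by exact (dehnEquiv 0).surjective)]
  congr 1
  simp [Set.image_insert_eq, Set.image_singleton, dehnEquiv_a,
    dehnEquiv_b_of_ne (show (2 : Fin 3) ≠ 0 by decide)]

/-- `T₀` stabilises `N₁ = ⟪a₁,b₂,a₃⟫`. [folklore] -/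
theorem map_dehnZero_s4Kernels_one :
    (s4Kernels 1).map (dehnEquiv 0).toMonoidHom = s4Kernels 1 := by
  have h1 : s4Kernels 1 = normalClosure {SurfaceGroup.a 0, SurfaceGroup.b 1, SurfaceGroup.a 2} := rfl
  rw [h1, map_normalClosure _ (dehnEquiv 0).toMonoidHom (by exact (dehnEquiv 0).surjective)]
  congr 1
  simp [Set.image_insert_eq, Set.image_singleton, dehnEquiv_a,
    dehnEquiv_b_of_ne (show (1 : Fin 3) ≠ 0 by decide)]

/-- … but `T₀` moves `N₂ = ⟪b₁,a₂,a₃⟫`: `T₀ b₁ = b₁a₁ ∈ T₀ N₂`, `b₁a₁ ∉ N₂` (erase `{b₁,a₂,a₃}`: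
`b₁a₁ ↦ a₁ ≠ 1`). [folklore] -/
theorem map_dehnZero_s4Kernels_two_ne :
    (s4Kernels 2).map (dehnEquiv 0).toMonoidHom ≠ s4Kernels 2 := by
  intro h
  have hmem : SurfaceGroup.b 0 * SurfaceGroup.a 0 ∈ s4Kernels 2 := by
    rw [← h, ← dehnEquiv_b_self]
    exact Subgroup.mem_map_of_mem _ (of_mem_s4Kernels 2 (x := ((0 : Fin 3), true)) (by decide))
  have hker := s4Kernels_le_ker (s4Gens 2) (s4Gens_hits 2) 2 le_rfl hmem
  rw [MonoidHom.mem_ker, map_mul] at hker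
  change eraseHom _ _ (PresentedGroup.of _) * eraseHom _ _ (PresentedGroup.of _) = 1 at hker
  rw [eraseHom_of, eraseHom_of, eraseGen_of_mem (by decide),
    eraseGen_of_not_mem (by decide), one_mul] at hker
  exact FreeGroup.of_ne_one _ hker

/-- REFUTED STRENGTHENING `PairsDetermineThird`: "an automorphism standardising the pair
`(K₀, K₁)` also standardises `K₂`" is FALSE already for `S⁴` (`m = 0`, `K = N`, `α = T₀` the
Dehn twist about the shared curve `a₁`: it lies in the Heegaard group `Stab N₀ ∩ Stab N₁` of the
standard genus-3 splitting of `S¹×S²` but `T₀ N₂ ≠ N₂`). This is the exact gap between the crux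
(pairs, 3-dimensional, a theorem) and simultaneous standardness `Iso N K` (the route's target
modulo stabilisation = SPC4): the three pairwise `α_{ij}` supplied by WaldhausenPairs differ by
elements of Heegaard groups which do not fix the third kernel. [folklore] -/
theorem not_pairsDetermineThird :
    ¬ ∀ (m : ℕ) (K : TrisectionKernels (3 + 3 * m)),
      IsGroupTrisection (3 + 3 * m) (m + 1) (PUnit : Type) K →
      ∀ α : SurfaceGroup (3 + 3 * m) ≃* SurfaceGroup (3 + 3 * m),
        (s4Kernels.stabilizeIter m 0).map α.toMonoidHom = K 0 →
        (s4Kernels.stabilizeIter m 1).map α.toMonoidHom = K 1 →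
        (s4Kernels.stabilizeIter m 2).map α.toMonoidHom = K 2 := fun h =>
  map_dehnZero_s4Kernels_two_ne
    (h 0 s4Kernels s4Kernels_isGroupTrisection_holds (dehnEquiv 0)
      map_dehnZero_s4Kernels_zero map_dehnZero_s4Kernels_one)

end Summit.SmoothPoincare4.SmoothPoincare4.Theorems.WaldhausenPairs.Negative

end
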